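import Literature.Topology.ProperPullbackDescent
import HarnessLib

/-!
# Patching maps and homeomorphisms over a two-piece proper cover

Topic `Literature/Topology`. The point-set half of "finite étale covers glue along a conductor
square" (descent of covering spaces along `X₁ ⊔ X₂ → X` for a Milnor/conductor square of varieties,
on complex points): let `p₁ : X₁ → X`, `p₂ : X₂ → X` be PROPER maps which jointly cover `X`, with
`p₂` injective (a closed piece) and `p₁` injective outside `p₂(X₂)` (e.g. a normalisation, an
isomorphism off the conductor locus `X₂`); let `q : Y → X`, `τ : T → X` be spaces over `X` and
`Φᵢ : Y ×_X Xᵢ ≃ T ×_X Xᵢ` homeomorphisms over `Xᵢ` (`i = 1, 2`) which are COMPATIBLE: points of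
`Y ×_X X₁` and `Y ×_X X₂` with the same `Y`-component have images with the same `T`-component.
Then the `Φᵢ` descend to a homeomorphism `Ψ : Y ≃ T` over `X` (`exists_homeomorph_of_patching`).

Proof: `ψ : Y → T` is defined piecewise (`exists_continuous_of_patching`); it is single-valued by
the compatibility and the injectivity hypotheses, continuous on each closed piece `q⁻¹(pᵢ(Xᵢ))`
because `Y ×_X Xᵢ → Y` is proper (`isProperMap_pullback_fst`, `ProperPullbackDescent.lean`), hence a
quotient map onto its range (`continuousOn_range_of_comp_continuous`), and the two closed pieces
cover `Y` (pasting lemma, Mathlib `ContinuousOn.union_of_isClosed`); the same construction for the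
`Φᵢ⁻¹` (whose compatibility follows from that of the `Φᵢ`) gives the inverse.

Pull-backs are the subtypes `{z : Y × Xᵢ // q z.1 = pᵢ z.2}` as in `ProperPullbackDescent.lean`.
Everything is proved; no named facts.

## References

* N. Bourbaki, *Topologie générale*, I §5 (proper maps), I §3.2 (pasting on closed covers) —
  folklore point-set topology; used for SGA1 XII 5.1 (Riemann's existence theorem), reduction to
  the normal case, in place of the analytic descent statement of SGA1 IX 4.7. [SGA1]
-/

noncomputable section

open Set Function Topology

namespace Literature.Topology

/-! ### Continuity on the range of a closed map -/

section ClosedRange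

variable {P Y T : Type*} [TopologicalSpace P] [TopologicalSpace Y] [TopologicalSpace T]

/-- A closed continuous map is a quotient map onto its range. [folklore] -/
theorem isQuotientMap_rangeFactorization {π : P → Y} (hπc : Continuous π) (hπ : IsClosedMap π) :
    IsQuotientMap (rangeFactorization π) := by
  refine IsClosedMap.isQuotientMap ?_ hπc.rangeFactorization rangeFactorization_surjective
  intro K hK
  have : rangeFactorization π '' K = Subtype.val ⁻¹' (π '' K) := by
    ext ⟨y, hy⟩
    simp only [mem_image, mem_preimage]
    constructor
    · rintro ⟨p, hp, hpy⟩
      exact ⟨p, hp, congrArg Subtype.val hpy⟩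
    · rintro ⟨p, hp, rfl⟩
      exact ⟨p, hp, rfl⟩
  rw [this]
  exact (hπ K hK).preimage continuous_subtype_val

/-- **A map is continuous on the range of a closed continuous map `π` as soon as its composite with
`π` is continuous.** [folklore] -/
theorem continuousOn_range_of_comp_continuous {π : P → Y} (hπc : Continuous π) (hπ : IsClosedMap π)
    {ψ : Y → T} (h : Continuous (ψ ∘ π)) : ContinuousOn ψ (range π) := by
  rw [continuousOn_iff_continuous_restrict]
  have hq := isQuotientMap_rangeFactorization hπc hπ
  rw [hq.continuous_iff]
  exact h

end ClosedRange

/-! ### Patching maps over a two-piece proper cover -/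

section Patching

variable {X X₁ X₂ Y T : Type*} [TopologicalSpace X] [TopologicalSpace X₁] [TopologicalSpace X₂]
  [TopologicalSpace Y] [TopologicalSpace T]
  (q : Y → X) (τ : T → X) (p₁ : X₁ → X) (p₂ : X₂ → X)

/-- **Patching a map over a two-piece proper cover.** Let `p₁ : X₁ → X`, `p₂ : X₂ → X` be proper
maps covering `X`, with `p₂` injective and `p₁` injective outside `p₂(X₂)`; let `q : Y → X` be
continuous and `τ : T → X` arbitrary; and let `F₁ : Y ×_X X₁ → T ×_X X₁`, `F₂ : Y ×_X X₂ → T ×_X X₂`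
be continuous maps over `X₁`, `X₂` which agree on `T`-components at points with the same
`Y`-component. Then there is a unique-valued continuous `ψ : Y → T` over `X` inducing `F₁` and `F₂`
on `T`-components. (Pull-backs are the subtypes `{z : Y × Xᵢ // q z.1 = pᵢ z.2}`.) [folklore] -/
theorem exists_continuous_of_patching (hq : Continuous q) (hp₁ : IsProperMap p₁) (hp₂ : IsProperMap p₂)
    (hcov : ∀ x, (∃ x₁, p₁ x₁ = x) ∨ ∃ x₂, p₂ x₂ = x) (hinj₂ : Injective p₂)
    (hinj₁ : ∀ x₁ x₁', p₁ x₁ = p₁ x₁' → x₁ = x₁' ∨ ∃ x₂, p₂ x₂ = p₁ x₁)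
    (F₁ : {z : Y × X₁ // q z.1 = p₁ z.2} → {z : T × X₁ // τ z.1 = p₁ z.2}) (hF₁c : Continuous F₁)
    (hF₁ : ∀ z, (F₁ z).1.2 = z.1.2)
    (F₂ : {z : Y × X₂ // q z.1 = p₂ z.2} → {z : T × X₂ // τ z.1 = p₂ z.2}) (hF₂c : Continuous F₂)
    (hF₂ : ∀ z, (F₂ z).1.2 = z.1.2)
    (hc : ∀ (z₁ : {z : Y × X₁ // q z.1 = p₁ z.2}) (z₂ : {z : Y × X₂ // q z.1 = p₂ z.2}),
      z₁.1.1 = z₂.1.1 → (F₁ z₁).1.1 = (F₂ z₂).1.1) :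
    ∃ ψ : Y → T, Continuous ψ ∧ (∀ y, τ (ψ y) = q y) ∧
      (∀ z, ψ z.1.1 = (F₁ z).1.1) ∧ ∀ z, ψ z.1.1 = (F₂ z).1.1 := by
  classical
  -- `F₁`, `F₂` are constant on the fibres over `Y`
  have key₁ : ∀ z z' : {z : Y × X₁ // q z.1 = p₁ z.2}, z.1.1 = z'.1.1 → (F₁ z).1.1 = (F₁ z').1.1 := by
    intro z z' h
    rcases hinj₁ z.1.2 z'.1.2 (by rw [← z.2, ← z'.2, h]) with h' | ⟨x₂, hx₂⟩
    · have : z = z' := Subtype.ext (Prod.ext h h')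
      rw [this]
    · let z₂ : {z : Y × X₂ // q z.1 = p₂ z.2} := ⟨(z.1.1, x₂), by rw [hx₂, z.2]⟩
      rw [hc z z₂ rfl, hc z' z₂ h.symm]
  have key₂ : ∀ z z' : {z : Y × X₂ // q z.1 = p₂ z.2}, z.1.1 = z'.1.1 → (F₂ z).1.1 = (F₂ z').1.1 := by
    intro z z' h
    have h' : z.1.2 = z'.1.2 := hinj₂ (by rw [← z.2, ← z'.2, h])
    have : z = z' := Subtype.ext (Prod.ext h h')
    rw [this]
  -- every `y` lies over `p₁(X₁)` or `p₂(X₂)`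
  have hcov' : ∀ y, ¬ (∃ x₁, p₁ x₁ = q y) → ∃ x₂, p₂ x₂ = q y := fun y h ↦ (hcov (q y)).resolve_left h
  let ψ : Y → T := fun y ↦
    if h : ∃ x₁, p₁ x₁ = q y then (F₁ ⟨(y, h.choose), h.choose_spec.symm⟩).1.1
    else (F₂ ⟨(y, (hcov' y h).choose), (hcov' y h).choose_spec.symm⟩).1.1
  have hψ₁ : ∀ z : {z : Y × X₁ // q z.1 = p₁ z.2}, ψ z.1.1 = (F₁ z).1.1 := by
    intro z
    have h : ∃ x₁, p₁ x₁ = q z.1.1 := ⟨z.1.2, z.2.symm⟩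
    simp only [ψ, dif_pos h]
    exact key₁ _ _ rfl
  have hψ₂ : ∀ z : {z : Y × X₂ // q z.1 = p₂ z.2}, ψ z.1.1 = (F₂ z).1.1 := by
    intro z
    by_cases h : ∃ x₁, p₁ x₁ = q z.1.1
    · simp only [ψ, dif_pos h]
      exact hc _ _ rfl
    · simp only [ψ, dif_neg h]
      exact key₂ _ _ rfl
  -- `ψ` lies over `X`
  have hover : ∀ y, τ (ψ y) = q y := by
    intro y
    by_cases h : ∃ x₁, p₁ x₁ = q y
    · let z : {z : Y × X₁ // q z.1 = p₁ z.2} := ⟨(y, h.choose), h.choose_spec.symm⟩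
      have e := hψ₁ z
      change ψ y = _ at e
      rw [e, (F₁ z).2, hF₁ z]
      exact h.choose_spec
    · obtain hx := hcov' y h
      let z : {z : Y × X₂ // q z.1 = p₂ z.2} := ⟨(y, hx.choose), hx.choose_spec.symm⟩
      have e := hψ₂ z
      change ψ y = _ at e
      rw [e, (F₂ z).2, hF₂ z]
      exact hx.choose_spec
  -- continuity on the two closed pieces `q⁻¹(pᵢ(Xᵢ))`, the ranges of the proper projections
  have hr₁ : range (fun z : {z : Y × X₁ // q z.1 = p₁ z.2} ↦ z.1.1) = q ⁻¹' range p₁ := by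
    ext y
    simp only [mem_range, mem_preimage]
    constructor
    · rintro ⟨z, rfl⟩
      exact ⟨z.1.2, z.2.symm⟩
    · rintro ⟨x₁, hx₁⟩
      exact ⟨⟨(y, x₁), hx₁.symm⟩, rfl⟩
  have hr₂ : range (fun z : {z : Y × X₂ // q z.1 = p₂ z.2} ↦ z.1.1) = q ⁻¹' range p₂ := by
    ext y
    simp only [mem_range, mem_preimage]
    constructor
    · rintro ⟨z, rfl⟩
      exact ⟨z.1.2, z.2.symm⟩
    · rintro ⟨x₂, hx₂⟩
      exact ⟨⟨(y, x₂), hx₂.symm⟩, rfl⟩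
  have hc₁ : ContinuousOn ψ (q ⁻¹' range p₁) := by
    rw [← hr₁]
    refine continuousOn_range_of_comp_continuous (by fun_prop) (isProperMap_pullback_fst q p₁ hq hp₁).isClosedMap ?_
    have : ψ ∘ (fun z : {z : Y × X₁ // q z.1 = p₁ z.2} ↦ z.1.1) = fun z ↦ (F₁ z).1.1 := funext hψ₁
    rw [this]
    fun_prop
  have hc₂ : ContinuousOn ψ (q ⁻¹' range p₂) := by
    rw [← hr₂]
    refine continuousOn_range_of_comp_continuous (by fun_prop) (isProperMap_pullback_fst q p₂ hq hp₂).isClosedMap ?_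
    have : ψ ∘ (fun z : {z : Y × X₂ // q z.1 = p₂ z.2} ↦ z.1.1) = fun z ↦ (F₂ z).1.1 := funext hψ₂
    rw [this]
    fun_prop
  have hunion : q ⁻¹' range p₁ ∪ q ⁻¹' range p₂ = univ := by
    ext y
    simp only [mem_union, mem_preimage, mem_range, mem_univ, iff_true]
    exact hcov (q y)
  have hcont : Continuous ψ := by
    rw [← continuousOn_univ, ← hunion]
    exact hc₁.union_of_isClosed hc₂ (hp₁.isClosedMap.isClosed_range.preimage hq)
      (hp₂.isClosedMap.isClosed_range.preimage hq)
  exact ⟨ψ, hcont, hover, hψ₁, hψ₂⟩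

/-- **Patching homeomorphisms over a two-piece proper cover.** Same setting, with `τ` continuous and
HOMEOMORPHISMS `Φ₁ : Y ×_X X₁ ≃ T ×_X X₁`, `Φ₂ : Y ×_X X₂ ≃ T ×_X X₂` over `X₁`, `X₂` compatible on
`T`-components at points with a common `Y`-component: then `Y ≃ T` over `X`, inducing `Φ₁`, `Φ₂`.
(The compatibility of the inverses follows.) This is the topological half of the descent of finite
étale covers along a conductor square `X = X₁ ⊔_{X₁₂} X₂`. [folklore] -/
theorem exists_homeomorph_of_patching (hq : Continuous q) (hτ : Continuous τ) (hp₁ : IsProperMap p₁)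
    (hp₂ : IsProperMap p₂) (hcov : ∀ x, (∃ x₁, p₁ x₁ = x) ∨ ∃ x₂, p₂ x₂ = x) (hinj₂ : Injective p₂)
    (hinj₁ : ∀ x₁ x₁', p₁ x₁ = p₁ x₁' → x₁ = x₁' ∨ ∃ x₂, p₂ x₂ = p₁ x₁)
    (Φ₁ : {z : Y × X₁ // q z.1 = p₁ z.2} ≃ₜ {z : T × X₁ // τ z.1 = p₁ z.2}) (hΦ₁ : ∀ z, (Φ₁ z).1.2 = z.1.2)
    (Φ₂ : {z : Y × X₂ // q z.1 = p₂ z.2} ≃ₜ {z : T × X₂ // τ z.1 = p₂ z.2}) (hΦ₂ : ∀ z, (Φ₂ z).1.2 = z.1.2)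
    (hc : ∀ (z₁ : {z : Y × X₁ // q z.1 = p₁ z.2}) (z₂ : {z : Y × X₂ // q z.1 = p₂ z.2}),
      z₁.1.1 = z₂.1.1 → (Φ₁ z₁).1.1 = (Φ₂ z₂).1.1) :
    ∃ Ψ : Y ≃ₜ T, (∀ y, τ (Ψ y) = q y) ∧
      (∀ z, Ψ z.1.1 = (Φ₁ z).1.1) ∧ ∀ z, Ψ z.1.1 = (Φ₂ z).1.1 := by
  -- the inverses are over `Xᵢ` and compatible as well
  have hΦ₁s : ∀ w, (Φ₁.symm w).1.2 = w.1.2 := fun w ↦ by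
    conv_rhs => rw [← Φ₁.apply_symm_apply w]
    exact (hΦ₁ _).symm
  have hΦ₂s : ∀ w, (Φ₂.symm w).1.2 = w.1.2 := fun w ↦ by
    conv_rhs => rw [← Φ₂.apply_symm_apply w]
    exact (hΦ₂ _).symm
  have hc' : ∀ (w₁ : {z : T × X₁ // τ z.1 = p₁ z.2}) (w₂ : {z : T × X₂ // τ z.1 = p₂ z.2}),
      w₁.1.1 = w₂.1.1 → (Φ₁.symm w₁).1.1 = (Φ₂.symm w₂).1.1 := by
    intro w₁ w₂ h
    -- `z₂' = (y, x₂)` with `y` the `Y`-component of `Φ₁⁻¹ w₁`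
    set z₁ := Φ₁.symm w₁ with hz₁
    have hq₁ : q z₁.1.1 = p₂ w₂.1.2 := by rw [z₁.2, hΦ₁s, w₁.2.symm.trans (h ▸ w₂.2)]
    let z₂' : {z : Y × X₂ // q z.1 = p₂ z.2} := ⟨(z₁.1.1, w₂.1.2), hq₁⟩
    have e : Φ₂ z₂' = w₂ := by
      apply Subtype.ext
      apply Prod.ext
      · rw [← hc z₁ z₂' rfl, hz₁, Φ₁.apply_symm_apply, h]
      · exact hΦ₂ z₂'
    rw [← e, Φ₂.symm_apply_apply]
  obtain ⟨ψ, hψc, hψ, hψ₁, hψ₂⟩ := exists_continuous_of_patching q τ p₁ p₂ hq hp₁ hp₂ hcov hinj₂ hinj₁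
    Φ₁ Φ₁.continuous hΦ₁ Φ₂ Φ₂.continuous hΦ₂ hc
  obtain ⟨ψ', hψ'c, hψ', hψ'₁, hψ'₂⟩ := exists_continuous_of_patching τ q p₁ p₂ hτ hp₁ hp₂ hcov hinj₂ hinj₁
    Φ₁.symm Φ₁.symm.continuous hΦ₁s Φ₂.symm Φ₂.symm.continuous hΦ₂s hc'
  -- `ψ' ∘ ψ = id` and `ψ ∘ ψ' = id`, checked on the pieces
  have hleft : ∀ y, ψ' (ψ y) = y := by
    intro y
    rcases hcov (q y) with ⟨x₁, hx₁⟩ | ⟨x₂, hx₂⟩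
    · let z : {z : Y × X₁ // q z.1 = p₁ z.2} := ⟨(y, x₁), hx₁.symm⟩
      have e1 : ψ y = (Φ₁ z).1.1 := hψ₁ z
      have e2 := hψ'₁ (Φ₁ z)
      rw [Φ₁.symm_apply_apply] at e2
      rw [e1, e2]
    · let z : {z : Y × X₂ // q z.1 = p₂ z.2} := ⟨(y, x₂), hx₂.symm⟩
      have e1 : ψ y = (Φ₂ z).1.1 := hψ₂ z
      have e2 := hψ'₂ (Φ₂ z)
      rw [Φ₂.symm_apply_apply] at e2
      rw [e1, e2]
  have hright : ∀ t, ψ (ψ' t) = t := by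
    intro t
    rcases hcov (τ t) with ⟨x₁, hx₁⟩ | ⟨x₂, hx₂⟩
    · let w : {z : T × X₁ // τ z.1 = p₁ z.2} := ⟨(t, x₁), hx₁.symm⟩
      have e1 : ψ' t = (Φ₁.symm w).1.1 := hψ'₁ w
      have e2 := hψ₁ (Φ₁.symm w)
      rw [Φ₁.apply_symm_apply] at e2
      rw [e1, e2]
    · let w : {z : T × X₂ // τ z.1 = p₂ z.2} := ⟨(t, x₂), hx₂.symm⟩
      have e1 : ψ' t = (Φ₂.symm w).1.1 := hψ'₂ w
      have e2 := hψ₂ (Φ₂.symm w)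
      rw [Φ₂.apply_symm_apply] at e2
      rw [e1, e2]
  let Ψ : Y ≃ₜ T :=
    { toFun := ψ
      invFun := ψ'
      left_inv := hleft
      right_inv := hright
      continuous_toFun := hψc
      continuous_invFun := hψ'c }
  exact ⟨Ψ, hψ, hψ₁, hψ₂⟩

end Patching

end Literature.Topology

end
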